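import Summits.AnomalousDissipation.AnomalousDissipation.Theses.MomentParity
import Literature.Analysis.FluidPDE.BeltramiWavesCurl
import Summits.AnomalousDissipation.AnomalousDissipation.Theorems.MomentParityQuarticGateSignLemma
import Summits.AnomalousDissipation.AnomalousDissipation.Theorems.MomentParityQuarticGateDefectCertificate
import Summits.AnomalousDissipation.AnomalousDissipation.Theorems.MomentParityQuarticGateSurgery
import Summits.AnomalousDissipation.AnomalousDissipation.Theorems.MomentParityQuarticGatestub_order3Surgery
import Summits.AnomalousDissipation.AnomalousDissipation.Theorems.MomentParityQuarticGateOrder2Design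

/-!
# Line `recession-cone` for crux `MomentParity.QuarticGate` (stmt-AnomalousDissipation-11464)
# — lead's INTEGRATED skeleton (prover-line-stmt-AnomalousDissipation-11464-r-0, 2026-08-16T07:30Z)

State after wave 1 (five stub-workers, all replies `stub-landed`):
* S1 `stub_signLemma`        — LANDED p77017 (Theorems/MomentParityQuarticGateSignLemma.lean)
* S3 `stub_defectCertificate` — LANDED p79409 (Theorems/MomentParityQuarticGateDefectCertificate.lean)
* S4 `stub_surgery`           — LANDED p79998 (Theorems/MomentParityQuarticGateSurgery.lean)
* S5 `stub_order3Surgery`     — LANDED p78453 (Theorems/MomentParityQuarticGatestub_order3Surgery.lean)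
* S6 `stub_order2Design`      — LANDED p87259 (Theorems/MomentParityQuarticGateOrder2Design.lean)
* S2 `stub_casimirs`          — OPEN: the only `sorry` left; the Casimir classification of ball-truncated
  3-D Galerkin–Euler at infinitely many levels (quadratic Casimirs = span{E,H}, no homogeneous cubic
  Casimir). Exact computation (cdisprove g2, Disproof.lean §G): both conjuncts hold at N = 2, the quadratic
  one at N = 3, 4; both FAIL at N = 1 (`B_1 ≡ 0`, Negative/LevelOne*.lean) — harmless for `∃ᶠ N`.
So, kernel-checked below: `QuarticGate ⟸ stub_casimirs`; the same implication is landed sorry-free as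
`Theorems/MomentParityQuarticGateOfCasimirs.lean` (`quarticGate_of_casimirs`). The parallel line
`axis-sectors` (lead prover-line-stmt-AnomalousDissipation-11464-0, Lines/axis_sectors.lean) runs this same
surgery shear-equivariantly so that only AXIAL momentum sectors of S2 are needed; it imports S1/S3/S4/S5's
landed packaging.

Vocabulary (all inlined): level-`N` field `u ∈ H`: `û(k) = 0` off `(freqBall N).erase 0`; band test
`g`: smooth, div-free, mean-zero, band-limited; observable `p(u) = P((u,g₁),…,(u,gₘ))`
(`MvPolynomial.eval` over `Torus.pairing`); its differential `∇p(u) = Σᵢ ∂ᵢP(…) gᵢ`; Euler derivative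
`{p,B_N}(u) = Torus.nsGeneratorPairing 0 0 u (∇p(u))`; row `∫ Torus.nsGeneratorPairing ν f u (∇p(u)) dμ`;
`d`-stationary = rows of tests of total degree `≤ d−1` integrable and zero; Slater = strictly positive
degree-4 Riesz functional on level-`N` fields; `P_N = Torus.fourierTruncate N`, `curl = BDSV.curl`.
-/

namespace Summit.AnomalousDissipation.AnomalousDissipation.Cruxes.QuarticGate.RecessionCone

open MeasureTheory Filter
open Literature.Analysis.FunctionSpaces Literature.Analysis.FluidPDE
open Summit.AnomalousDissipation.AnomalousDissipation.Theses.MomentParity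

set_option linter.dupNamespace false

/-! ## The stubs (S1–S6) -/

/-- **S1 — Gaussian/Liouville SIGN LEMMA (K3 i; unchanged from the planner's skeleton, unfolded).**
A polynomial cylindrical observable `p(u) = P((u,g₁),…,(u,gₘ))` with level-`N` test fields whose
Euler derivative `{p,B_N}(u) = nsGeneratorPairing 0 0 u (∇p(u)) = −b(u,u,∇p(u))` is `≥ 0` at every
level-`N` field has `{p,B_N} ≡ 0` on level-`N` fields.
Why true: in frame coordinates `c ∈ ℝ^F` of `V_N` (Parseval frame `frameField`, synthesis `T*`),
`q(c) := {p,B_N}(T*c) = Dp̃(c)[Ẽ(c)]` with `Ẽ(c)_a = inertialPairing (T*c) e_a` (Galerkin–Euler in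
frame coordinates), `div_c Ẽ = 0` (each frame mode `a cos(2πk·x)`, `a ⊥ k`, has `(e·∇)e = 0`, and
`∫⟪De_a u, e_a⟫ = ½∫ u·∇|e_a|² = 0`) and `Ẽ(c)·c = inertialPairing (T*c) (T*c) = 0`; hence for a
radial bump `ψ(|c|²)`, `∫ ψ q dc = ∫ div(ψ p̃ Ẽ) dc = 0` (divergence theorem on a box,
`MeasureTheory.integral_divergence_of_hasFDerivWithinAt_off_countable`, integrand compactly
supported), so the continuous `q ≥ 0` vanishes identically. Size M–L. -/
theorem stub_signLemma :
    ∀ (N m : ℕ) (g : Fin m → UnitAddTorus (Fin 3) → EuclideanSpace ℝ (Fin 3))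
      (P : MvPolynomial (Fin m) ℝ),
      (∀ i, (Torus.IsSmooth (g i) ∧ Torus.IsDivFree (g i) ∧ Torus.HasZeroMean (g i) ∧
        ∀ k ∉ (Torus.freqBall N).erase (0 : Fin 3 → ℤ),
          UnitAddTorus.mFourierCoeff (EuclideanSpace.complexify ∘ (g i)) k = 0)) →
      (∀ u : Torus.energySpace (Fin 3), (∀ k ∉ (Torus.freqBall N).erase (0 : Fin 3 → ℤ),
          UnitAddTorus.mFourierCoeff (EuclideanSpace.complexify ∘ (u.1 : UnitAddTorus (Fin 3) → EuclideanSpace ℝ (Fin 3))) k = 0) →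
        0 ≤ Torus.nsGeneratorPairing (d := Fin 3) 0 0 u
          (fun x => ∑ i, (MvPolynomial.eval (fun j => Torus.pairing u.1 (g j))
            (MvPolynomial.pderiv i P)) • g i x)) →
      ∀ u : Torus.energySpace (Fin 3), (∀ k ∉ (Torus.freqBall N).erase (0 : Fin 3 → ℤ),
          UnitAddTorus.mFourierCoeff (EuclideanSpace.complexify ∘ (u.1 : UnitAddTorus (Fin 3) → EuclideanSpace ℝ (Fin 3))) k = 0) →
        Torus.nsGeneratorPairing (d := Fin 3) 0 0 u
          (fun x => ∑ i, (MvPolynomial.eval (fun j => Torus.pairing u.1 (g j))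
            (MvPolynomial.pderiv i P)) • g i x) = 0 :=
  Summit.AnomalousDissipation.AnomalousDissipation.Theorems.MomentParityQuarticGate.stub_signLemma

/-- **S2 — CASIMIR CLASSIFICATION at infinitely many levels (K2, merged: cubic AND quadratic).**
For frequently many `N`: (i) level-`N` Galerkin–Euler (ball truncation `0 < |k|² ≤ N²` of 3-D Euler
on the unit torus) has no nonzero HOMOGENEOUS CUBIC polynomial invariant; (ii) QuadRigidity: every
homogeneous QUADRATIC invariant is `α|u|² + β(u, curl u)` on `V_N`, stated through its gradient:
`∇p(u) = 2α P_N u + 2β curl P_N u` at level-`N` fields (`P_N = Torus.fourierTruncate N`,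
`curl = BDSV.curl`). (ii) is needed because the composition pairs S2's levels with S6's `N ≥ N₀(ν)`
(`Frequently.and_eventually`), so both classifications must hold at the SAME levels.
Why plausibly true: folklore (Kraichnan 1973: `E`, `H` are the only quadratic invariants of
truncated 3-D Euler; no cubic one is known, Cichowlas et al. arXiv:nlin/0410064 p. 4) + exact-rank
evidence on the item (casimir_evidence.txt: quadratic nullity 2 = span{E,H} at 26 and 32
wavevectors, cubic nullity 0 through level 2; kit j003367/j007170). Device: momentum grading
(translation covariance splits an invariant into characters `θ ∈ ℤ³`), invariance is a finite
linear system triad by triad, propagate along chains of triads sharing two legs inside the ball.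
Why it might fail: accidental invariants at special `N` (the 18-wavevector set `|k|² ≤ 2` has a third
quadratic invariant) — harmless unless they persist for all large `N`. THE CONJECTURAL CONTENT OF THE
LINE. Size L–XL (combinatorial linear algebra over `Torus.freqBall`). -/
theorem stub_casimirs :
    ∃ᶠ N in atTop,
    (∀ (m : ℕ) (g : Fin m → UnitAddTorus (Fin 3) → EuclideanSpace ℝ (Fin 3))
      (P : MvPolynomial (Fin m) ℝ),
      (∀ i, (Torus.IsSmooth (g i) ∧ Torus.IsDivFree (g i) ∧ Torus.HasZeroMean (g i) ∧
        ∀ k ∉ (Torus.freqBall N).erase (0 : Fin 3 → ℤ),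
          UnitAddTorus.mFourierCoeff (EuclideanSpace.complexify ∘ (g i)) k = 0)) → P.IsHomogeneous 3 →
      (∀ u : Torus.energySpace (Fin 3), (∀ k ∉ (Torus.freqBall N).erase (0 : Fin 3 → ℤ),
          UnitAddTorus.mFourierCoeff (EuclideanSpace.complexify ∘ (u.1 : UnitAddTorus (Fin 3) → EuclideanSpace ℝ (Fin 3))) k = 0) →
        Torus.nsGeneratorPairing (d := Fin 3) 0 0 u
          (fun x => ∑ i, (MvPolynomial.eval (fun j => Torus.pairing u.1 (g j))
            (MvPolynomial.pderiv i P)) • g i x) = 0) →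
      ∀ u : Torus.energySpace (Fin 3), (∀ k ∉ (Torus.freqBall N).erase (0 : Fin 3 → ℤ),
          UnitAddTorus.mFourierCoeff (EuclideanSpace.complexify ∘ (u.1 : UnitAddTorus (Fin 3) → EuclideanSpace ℝ (Fin 3))) k = 0) →
        MvPolynomial.eval (fun j => Torus.pairing u.1 (g j)) P = 0) ∧
    (∀ (m : ℕ) (g : Fin m → UnitAddTorus (Fin 3) → EuclideanSpace ℝ (Fin 3))
      (P : MvPolynomial (Fin m) ℝ),
      (∀ i, (Torus.IsSmooth (g i) ∧ Torus.IsDivFree (g i) ∧ Torus.HasZeroMean (g i) ∧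
        ∀ k ∉ (Torus.freqBall N).erase (0 : Fin 3 → ℤ),
          UnitAddTorus.mFourierCoeff (EuclideanSpace.complexify ∘ (g i)) k = 0)) → P.IsHomogeneous 2 →
      (∀ u : Torus.energySpace (Fin 3), (∀ k ∉ (Torus.freqBall N).erase (0 : Fin 3 → ℤ),
          UnitAddTorus.mFourierCoeff (EuclideanSpace.complexify ∘ (u.1 : UnitAddTorus (Fin 3) → EuclideanSpace ℝ (Fin 3))) k = 0) →
        Torus.nsGeneratorPairing (d := Fin 3) 0 0 u
          (fun x => ∑ i, (MvPolynomial.eval (fun j => Torus.pairing u.1 (g j))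
            (MvPolynomial.pderiv i P)) • g i x) = 0) →
      ∃ α β : ℝ, ∀ u : Torus.energySpace (Fin 3), (∀ k ∉ (Torus.freqBall N).erase (0 : Fin 3 → ℤ),
          UnitAddTorus.mFourierCoeff (EuclideanSpace.complexify ∘ (u.1 : UnitAddTorus (Fin 3) → EuclideanSpace ℝ (Fin 3))) k = 0) →
        ∀ x, (∑ i, (MvPolynomial.eval (fun j => Torus.pairing u.1 (g j))
            (MvPolynomial.pderiv i P)) • g i x) =
          (2 * α) • Torus.fourierTruncate N (u.1 : UnitAddTorus (Fin 3) → EuclideanSpace ℝ (Fin 3)) x +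
          (2 * β) • BDSV.curl (Torus.fourierTruncate N (u.1 : UnitAddTorus (Fin 3) → EuclideanSpace ℝ (Fin 3))) x) := by
  sorry

/-- **S3 — DEFECT CERTIFICATE (K3 ii, THE LEVER: recession cone of the quartic moment cone;
unchanged, unfolded).** Assume the sign lemma (S1, as a hypothesis) and no homogeneous cubic Casimir
at level `N`. Then for every viscosity, smooth force and level-`N` probability law `μ` with finite
fourth moments there are finitely many level-`N` fields `vᵢ` and weights `cᵢ ≥ 0` with
`row_μ(p₃) + Σᵢ cᵢ {p₃,B_N}(vᵢ) = 0` for every homogeneous cubic test `p₃`.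
Why true: `W :=` homogeneous cubic polynomial functions on `V_N` (finite-dimensional);
`ψ := −row_μ|_W ∈ W*` is well defined (the row depends on `(g,P)` only through `p|_{V_N}`: `∇p(u)` is
the `V_N`-gradient of `p|_{V_N}` at level-`N` `u`; `f` smooth and `∫‖u‖⁴ < ∞` give integrability and
linearity); `C := cone{ev_v : v ∈ V_N}`, `ev_v(p₃) = {p₃,B_N}(v)`, is a convex cone whose dual
`{p₃ : {p₃,B_N} ≥ 0 on V_N}` is `{0}` by the two hypotheses; a convex cone with trivial dual in a
finite-dimensional space is everything, so `ψ ∈ C`. Size M–L. -/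
theorem stub_defectCertificate :
    (∀ (N m : ℕ) (g : Fin m → UnitAddTorus (Fin 3) → EuclideanSpace ℝ (Fin 3))
      (P : MvPolynomial (Fin m) ℝ),
      (∀ i, (Torus.IsSmooth (g i) ∧ Torus.IsDivFree (g i) ∧ Torus.HasZeroMean (g i) ∧
        ∀ k ∉ (Torus.freqBall N).erase (0 : Fin 3 → ℤ),
          UnitAddTorus.mFourierCoeff (EuclideanSpace.complexify ∘ (g i)) k = 0)) →
      (∀ u : Torus.energySpace (Fin 3), (∀ k ∉ (Torus.freqBall N).erase (0 : Fin 3 → ℤ),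
          UnitAddTorus.mFourierCoeff (EuclideanSpace.complexify ∘ (u.1 : UnitAddTorus (Fin 3) → EuclideanSpace ℝ (Fin 3))) k = 0) →
        0 ≤ Torus.nsGeneratorPairing (d := Fin 3) 0 0 u
          (fun x => ∑ i, (MvPolynomial.eval (fun j => Torus.pairing u.1 (g j))
            (MvPolynomial.pderiv i P)) • g i x)) →
      ∀ u : Torus.energySpace (Fin 3), (∀ k ∉ (Torus.freqBall N).erase (0 : Fin 3 → ℤ),
          UnitAddTorus.mFourierCoeff (EuclideanSpace.complexify ∘ (u.1 : UnitAddTorus (Fin 3) → EuclideanSpace ℝ (Fin 3))) k = 0) →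
        Torus.nsGeneratorPairing (d := Fin 3) 0 0 u
          (fun x => ∑ i, (MvPolynomial.eval (fun j => Torus.pairing u.1 (g j))
            (MvPolynomial.pderiv i P)) • g i x) = 0) →
    ∀ N : ℕ, (∀ (m : ℕ) (g : Fin m → UnitAddTorus (Fin 3) → EuclideanSpace ℝ (Fin 3))
      (P : MvPolynomial (Fin m) ℝ),
      (∀ i, (Torus.IsSmooth (g i) ∧ Torus.IsDivFree (g i) ∧ Torus.HasZeroMean (g i) ∧
        ∀ k ∉ (Torus.freqBall N).erase (0 : Fin 3 → ℤ),
          UnitAddTorus.mFourierCoeff (EuclideanSpace.complexify ∘ (g i)) k = 0)) → P.IsHomogeneous 3 →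
      (∀ u : Torus.energySpace (Fin 3), (∀ k ∉ (Torus.freqBall N).erase (0 : Fin 3 → ℤ),
          UnitAddTorus.mFourierCoeff (EuclideanSpace.complexify ∘ (u.1 : UnitAddTorus (Fin 3) → EuclideanSpace ℝ (Fin 3))) k = 0) →
        Torus.nsGeneratorPairing (d := Fin 3) 0 0 u
          (fun x => ∑ i, (MvPolynomial.eval (fun j => Torus.pairing u.1 (g j))
            (MvPolynomial.pderiv i P)) • g i x) = 0) →
      ∀ u : Torus.energySpace (Fin 3), (∀ k ∉ (Torus.freqBall N).erase (0 : Fin 3 → ℤ),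
          UnitAddTorus.mFourierCoeff (EuclideanSpace.complexify ∘ (u.1 : UnitAddTorus (Fin 3) → EuclideanSpace ℝ (Fin 3))) k = 0) →
        MvPolynomial.eval (fun j => Torus.pairing u.1 (g j)) P = 0) →
    ∀ (ν : ℝ) (f : UnitAddTorus (Fin 3) → EuclideanSpace ℝ (Fin 3)), Torus.IsSmooth f →
    ∀ μ : Measure (Torus.energySpace (Fin 3)), IsProbabilityMeasure μ →
      (∀ᵐ u ∂μ, (∀ k ∉ (Torus.freqBall N).erase (0 : Fin 3 → ℤ),
          UnitAddTorus.mFourierCoeff (EuclideanSpace.complexify ∘ (u.1 : UnitAddTorus (Fin 3) → EuclideanSpace ℝ (Fin 3))) k = 0)) → Integrable (fun u : Torus.energySpace (Fin 3) => ‖u‖ ^ 4) μ →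
      ∃ (M : ℕ) (v : Fin M → Torus.energySpace (Fin 3)) (c : Fin M → ℝ),
      ((∀ l, (∀ k ∉ (Torus.freqBall N).erase (0 : Fin 3 → ℤ),
          UnitAddTorus.mFourierCoeff (EuclideanSpace.complexify ∘ ((v l).1 : UnitAddTorus (Fin 3) → EuclideanSpace ℝ (Fin 3))) k = 0)) ∧ (∀ l, 0 ≤ c l) ∧
      ∀ (m : ℕ) (g : Fin m → UnitAddTorus (Fin 3) → EuclideanSpace ℝ (Fin 3))
      (P : MvPolynomial (Fin m) ℝ),
      (∀ i, (Torus.IsSmooth (g i) ∧ Torus.IsDivFree (g i) ∧ Torus.HasZeroMean (g i) ∧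
        ∀ k ∉ (Torus.freqBall N).erase (0 : Fin 3 → ℤ),
          UnitAddTorus.mFourierCoeff (EuclideanSpace.complexify ∘ (g i)) k = 0)) → P.IsHomogeneous 3 →
      ∫ u, Torus.nsGeneratorPairing ν f u
          (fun x => ∑ i, (MvPolynomial.eval (fun j => Torus.pairing u.1 (g j))
            (MvPolynomial.pderiv i P)) • g i x) ∂μ +
        ∑ l, c l * Torus.nsGeneratorPairing (d := Fin 3) 0 0 (v l)
          (fun x => ∑ i, (MvPolynomial.eval (fun j => Torus.pairing (v l).1 (g j))
            (MvPolynomial.pderiv i P)) • g i x) = 0) :=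
  Summit.AnomalousDissipation.AnomalousDissipation.Theorems.MomentParityQuarticGate.stub_defectCertificate

/-- **S4 — EXACT FAR-ATOM SURGERY AT ORDER 4 (K3 iii; unchanged, unfolded).** A level-`N`
probability law `μ₀` with finite fourth moments and STRICTLY positive degree-4 Riesz functional on
`V_N` (Slater), 3-stationary at `(ν,f,N)`, plus a defect certificate `(vᵢ,cᵢ)` ⟹ a level-`N`
probability law, finite fourth moments, 4-STATIONARY, same mean energy and dissipation.
Why true: `w := R⁻⁴Σcᵢ`, `μ := (1−w)μ₀' + Σᵢ cᵢR⁻⁴·½(δ_{Rvᵢ}+δ_{−Rvᵢ})`, `μ₀'` any law on `V_N` with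
degree-4 moments `(1, M₁, M₂ − R⁻²Σcᵢvᵢvᵢᵀ, M₃, M₄)(μ₀)/(1−w)`; strict positivity is open, so for
`R ≫ 1` Fialkow–Nie (`Literature.MeasureTheory.Moments.FialkowNie2010_thm13_holds`, PROVED) realises
it; `μ` has moments exactly `(1, M₁, M₂, M₃, M₄(μ₀)+Σcᵢvᵢ^⊗4)`: rows of test degree `≤ 2` unchanged
(`= 0`), cubic rows shifted by the certificate (`= 0`), energy/dissipation quadratic hence unchanged.
Size L. -/
theorem stub_surgery :
    ∀ (ν : ℝ) (f : UnitAddTorus (Fin 3) → EuclideanSpace ℝ (Fin 3)) (N : ℕ) (μ₀ : Measure (Torus.energySpace (Fin 3))),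
    Torus.IsSmooth f → IsProbabilityMeasure μ₀ → (∀ᵐ u ∂μ₀, (∀ k ∉ (Torus.freqBall N).erase (0 : Fin 3 → ℤ),
          UnitAddTorus.mFourierCoeff (EuclideanSpace.complexify ∘ (u.1 : UnitAddTorus (Fin 3) → EuclideanSpace ℝ (Fin 3))) k = 0)) →
    Integrable (fun u : Torus.energySpace (Fin 3) => ‖u‖ ^ 4) μ₀ →
    (∀ (m : ℕ) (g : Fin m → UnitAddTorus (Fin 3) → EuclideanSpace ℝ (Fin 3))
      (P : MvPolynomial (Fin m) ℝ),
      (∀ i, (Torus.IsSmooth (g i) ∧ Torus.IsDivFree (g i) ∧ Torus.HasZeroMean (g i) ∧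
        ∀ k ∉ (Torus.freqBall N).erase (0 : Fin 3 → ℤ),
          UnitAddTorus.mFourierCoeff (EuclideanSpace.complexify ∘ (g i)) k = 0)) → P.totalDegree ≤ 4 →
      (∀ u : Torus.energySpace (Fin 3), (∀ k ∉ (Torus.freqBall N).erase (0 : Fin 3 → ℤ),
          UnitAddTorus.mFourierCoeff (EuclideanSpace.complexify ∘ (u.1 : UnitAddTorus (Fin 3) → EuclideanSpace ℝ (Fin 3))) k = 0) →
        0 ≤ MvPolynomial.eval (fun j => Torus.pairing u.1 (g j)) P) →
      (∃ u : Torus.energySpace (Fin 3), (∀ k ∉ (Torus.freqBall N).erase (0 : Fin 3 → ℤ),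
          UnitAddTorus.mFourierCoeff (EuclideanSpace.complexify ∘ (u.1 : UnitAddTorus (Fin 3) → EuclideanSpace ℝ (Fin 3))) k = 0) ∧
        MvPolynomial.eval (fun j => Torus.pairing u.1 (g j)) P ≠ 0) →
      0 < ∫ u, MvPolynomial.eval (fun j => Torus.pairing u.1 (g j)) P ∂μ₀) →
    (∀ (m : ℕ) (g : Fin m → UnitAddTorus (Fin 3) → EuclideanSpace ℝ (Fin 3))
      (P : MvPolynomial (Fin m) ℝ),
      (∀ i, (Torus.IsSmooth (g i) ∧ Torus.IsDivFree (g i) ∧ Torus.HasZeroMean (g i) ∧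
        ∀ k ∉ (Torus.freqBall N).erase (0 : Fin 3 → ℤ),
          UnitAddTorus.mFourierCoeff (EuclideanSpace.complexify ∘ (g i)) k = 0)) → P.totalDegree + 1 ≤ 3 →
      Integrable (fun u : Torus.energySpace (Fin 3) => Torus.nsGeneratorPairing ν f u
          (fun x => ∑ i, (MvPolynomial.eval (fun j => Torus.pairing u.1 (g j))
            (MvPolynomial.pderiv i P)) • g i x)) μ₀ ∧
      ∫ u, Torus.nsGeneratorPairing ν f u
          (fun x => ∑ i, (MvPolynomial.eval (fun j => Torus.pairing u.1 (g j))
            (MvPolynomial.pderiv i P)) • g i x) ∂μ₀ = 0) →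
    ∀ (M : ℕ) (v : Fin M → Torus.energySpace (Fin 3)) (c : Fin M → ℝ),
    ((∀ l, (∀ k ∉ (Torus.freqBall N).erase (0 : Fin 3 → ℤ),
          UnitAddTorus.mFourierCoeff (EuclideanSpace.complexify ∘ ((v l).1 : UnitAddTorus (Fin 3) → EuclideanSpace ℝ (Fin 3))) k = 0)) ∧ (∀ l, 0 ≤ c l) ∧
      ∀ (m : ℕ) (g : Fin m → UnitAddTorus (Fin 3) → EuclideanSpace ℝ (Fin 3))
      (P : MvPolynomial (Fin m) ℝ),
      (∀ i, (Torus.IsSmooth (g i) ∧ Torus.IsDivFree (g i) ∧ Torus.HasZeroMean (g i) ∧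
        ∀ k ∉ (Torus.freqBall N).erase (0 : Fin 3 → ℤ),
          UnitAddTorus.mFourierCoeff (EuclideanSpace.complexify ∘ (g i)) k = 0)) → P.IsHomogeneous 3 →
      ∫ u, Torus.nsGeneratorPairing ν f u
          (fun x => ∑ i, (MvPolynomial.eval (fun j => Torus.pairing u.1 (g j))
            (MvPolynomial.pderiv i P)) • g i x) ∂μ₀ +
        ∑ l, c l * Torus.nsGeneratorPairing (d := Fin 3) 0 0 (v l)
          (fun x => ∑ i, (MvPolynomial.eval (fun j => Torus.pairing (v l).1 (g j))
            (MvPolynomial.pderiv i P)) • g i x) = 0) →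
    ∃ μ : Measure (Torus.energySpace (Fin 3)), IsProbabilityMeasure μ ∧ (∀ᵐ u ∂μ, (∀ k ∉ (Torus.freqBall N).erase (0 : Fin 3 → ℤ),
          UnitAddTorus.mFourierCoeff (EuclideanSpace.complexify ∘ (u.1 : UnitAddTorus (Fin 3) → EuclideanSpace ℝ (Fin 3))) k = 0)) ∧
      Integrable (fun u : Torus.energySpace (Fin 3) => ‖u‖ ^ 4) μ ∧
      (∀ (m : ℕ) (g : Fin m → UnitAddTorus (Fin 3) → EuclideanSpace ℝ (Fin 3))
      (P : MvPolynomial (Fin m) ℝ),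
      (∀ i, (Torus.IsSmooth (g i) ∧ Torus.IsDivFree (g i) ∧ Torus.HasZeroMean (g i) ∧
        ∀ k ∉ (Torus.freqBall N).erase (0 : Fin 3 → ℤ),
          UnitAddTorus.mFourierCoeff (EuclideanSpace.complexify ∘ (g i)) k = 0)) → P.totalDegree + 1 ≤ 4 →
      Integrable (fun u : Torus.energySpace (Fin 3) => Torus.nsGeneratorPairing ν f u
          (fun x => ∑ i, (MvPolynomial.eval (fun j => Torus.pairing u.1 (g j))
            (MvPolynomial.pderiv i P)) • g i x)) μ ∧
      ∫ u, Torus.nsGeneratorPairing ν f u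
          (fun x => ∑ i, (MvPolynomial.eval (fun j => Torus.pairing u.1 (g j))
            (MvPolynomial.pderiv i P)) • g i x) ∂μ = 0) ∧
      Torus.ensembleEnergy μ = Torus.ensembleEnergy μ₀ ∧
      Torus.ensembleDissipation ν μ = Torus.ensembleDissipation ν μ₀ :=
  Summit.AnomalousDissipation.AnomalousDissipation.Theorems.MomentParityQuarticGate.stub_surgery

/-- **S5 — ORDER-3 SURGERY + SLATER UPGRADE (NEW: replaces `stub_slaterUpgrade`, absorbs the
quadratic-row part of the old `stub_order3LoudNondegenerate`).** A level-`N` probability law `μ₀`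
with bounded support and NONDEGENERATE covariance on `V_N` whose LINEAR rows (mean-flow balance), ENERGY
row (`∫ ⟨F(u), P_N u⟩ dμ₀ = 0`) and HELICITY row (`∫ ⟨F(u), curl P_N u⟩ dμ₀ = 0`) vanish, at a level
where QuadRigidity holds ⟹ a level-`N` law `μ₁` with finite fourth moments, Slater at degree 4,
3-STATIONARY (all rows of test degree ≤ 2), same mean energy and dissipation.
Why true (the recession lever one order down — odd far atoms make `M₃` free modulo quadratic
Casimirs): the row of a quadratic test is affine in `(M₁,M₂,M₃)` and sees `M₃` only through the cubic
form `{p₂,B_N}`; the defect functional `p₂ ↦ row_{μ₀}(p₂)` (well defined on `p₂|_{V_N}`) vanishes on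
`ker(p₂ ↦ {p₂,B_N}|_{V_N})` = quadratic Casimirs = (QuadRigidity) tests with
`∇p = 2αP_N u + 2β curl P_N u`, whose rows are `2α·(energy row) + 2β·(helicity row) = 0`; so it factors
through `{·,B_N}` and is killed by a shift `S` of the third moments. Realise
`y_λ := (1, M₁(μ₀), M₂(μ₀), M₃(μ₀)+S, λ·M₄⁰)` for `λ ≫ 1` by Fialkow–Nie at degree 4 on frame
coordinates (strict positivity: a limit of failing normalised `p ≥ 0` would have `p₄ = 0`, then
`p₃ = 0`, then `E_{μ₀}[p_{≤2}] ≤ 0` for a nonzero nonneg quadratic polynomial — impossible with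
nondegenerate covariance); push forward along the synthesis map `ℝ^F → V_N ⊂ H`. Rows of degree
`≤ 1` tests, energy and dissipation depend on `M_{≤2}` only — unchanged. Size L–XL. -/
theorem stub_order3Surgery :
    ∀ (ν : ℝ) (f : UnitAddTorus (Fin 3) → EuclideanSpace ℝ (Fin 3)) (N : ℕ) (μ₀ : Measure (Torus.energySpace (Fin 3))),
    Torus.IsSmooth f → IsProbabilityMeasure μ₀ → (∀ᵐ u ∂μ₀, (∀ k ∉ (Torus.freqBall N).erase (0 : Fin 3 → ℤ),
          UnitAddTorus.mFourierCoeff (EuclideanSpace.complexify ∘ (u.1 : UnitAddTorus (Fin 3) → EuclideanSpace ℝ (Fin 3))) k = 0)) →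
    (∃ R : ℝ, ∀ᵐ u ∂μ₀, ‖u‖ ≤ R) →
    (∀ g : UnitAddTorus (Fin 3) → EuclideanSpace ℝ (Fin 3), (Torus.IsSmooth (g) ∧ Torus.IsDivFree (g) ∧ Torus.HasZeroMean (g) ∧
        ∀ k ∉ (Torus.freqBall N).erase (0 : Fin 3 → ℤ),
          UnitAddTorus.mFourierCoeff (EuclideanSpace.complexify ∘ (g)) k = 0) →
      (∃ u : Torus.energySpace (Fin 3), (∀ k ∉ (Torus.freqBall N).erase (0 : Fin 3 → ℤ),
          UnitAddTorus.mFourierCoeff (EuclideanSpace.complexify ∘ (u.1 : UnitAddTorus (Fin 3) → EuclideanSpace ℝ (Fin 3))) k = 0) ∧ Torus.pairing u.1 g ≠ 0) →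
      (∫ u : Torus.energySpace (Fin 3), Torus.pairing u.1 g ∂μ₀) ^ 2 < ∫ u : Torus.energySpace (Fin 3), (Torus.pairing u.1 g) ^ 2 ∂μ₀) →
    (∀ g : UnitAddTorus (Fin 3) → EuclideanSpace ℝ (Fin 3), (Torus.IsSmooth (g) ∧ Torus.IsDivFree (g) ∧ Torus.HasZeroMean (g) ∧
        ∀ k ∉ (Torus.freqBall N).erase (0 : Fin 3 → ℤ),
          UnitAddTorus.mFourierCoeff (EuclideanSpace.complexify ∘ (g)) k = 0) →
      Integrable (fun u : Torus.energySpace (Fin 3) => Torus.nsGeneratorPairing ν f u g) μ₀ ∧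
      ∫ u : Torus.energySpace (Fin 3), Torus.nsGeneratorPairing ν f u g ∂μ₀ = 0) →
    (Integrable (fun u : Torus.energySpace (Fin 3) => Torus.nsGeneratorPairing ν f u (Torus.fourierTruncate N (u.1 : UnitAddTorus (Fin 3) → EuclideanSpace ℝ (Fin 3)))) μ₀ ∧
      ∫ u : Torus.energySpace (Fin 3), Torus.nsGeneratorPairing ν f u (Torus.fourierTruncate N (u.1 : UnitAddTorus (Fin 3) → EuclideanSpace ℝ (Fin 3))) ∂μ₀ = 0) →
    (Integrable (fun u : Torus.energySpace (Fin 3) => Torus.nsGeneratorPairing ν f u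
        (BDSV.curl (Torus.fourierTruncate N (u.1 : UnitAddTorus (Fin 3) → EuclideanSpace ℝ (Fin 3))))) μ₀ ∧
      ∫ u : Torus.energySpace (Fin 3), Torus.nsGeneratorPairing ν f u (BDSV.curl (Torus.fourierTruncate N (u.1 : UnitAddTorus (Fin 3) → EuclideanSpace ℝ (Fin 3)))) ∂μ₀ = 0) →
    (∀ (m : ℕ) (g : Fin m → UnitAddTorus (Fin 3) → EuclideanSpace ℝ (Fin 3))
      (P : MvPolynomial (Fin m) ℝ),
      (∀ i, (Torus.IsSmooth (g i) ∧ Torus.IsDivFree (g i) ∧ Torus.HasZeroMean (g i) ∧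
        ∀ k ∉ (Torus.freqBall N).erase (0 : Fin 3 → ℤ),
          UnitAddTorus.mFourierCoeff (EuclideanSpace.complexify ∘ (g i)) k = 0)) → P.IsHomogeneous 2 →
      (∀ u : Torus.energySpace (Fin 3), (∀ k ∉ (Torus.freqBall N).erase (0 : Fin 3 → ℤ),
          UnitAddTorus.mFourierCoeff (EuclideanSpace.complexify ∘ (u.1 : UnitAddTorus (Fin 3) → EuclideanSpace ℝ (Fin 3))) k = 0) →
        Torus.nsGeneratorPairing (d := Fin 3) 0 0 u
          (fun x => ∑ i, (MvPolynomial.eval (fun j => Torus.pairing u.1 (g j))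
            (MvPolynomial.pderiv i P)) • g i x) = 0) →
      ∃ α β : ℝ, ∀ u : Torus.energySpace (Fin 3), (∀ k ∉ (Torus.freqBall N).erase (0 : Fin 3 → ℤ),
          UnitAddTorus.mFourierCoeff (EuclideanSpace.complexify ∘ (u.1 : UnitAddTorus (Fin 3) → EuclideanSpace ℝ (Fin 3))) k = 0) →
        ∀ x, (∑ i, (MvPolynomial.eval (fun j => Torus.pairing u.1 (g j))
            (MvPolynomial.pderiv i P)) • g i x) =
          (2 * α) • Torus.fourierTruncate N (u.1 : UnitAddTorus (Fin 3) → EuclideanSpace ℝ (Fin 3)) x +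
          (2 * β) • BDSV.curl (Torus.fourierTruncate N (u.1 : UnitAddTorus (Fin 3) → EuclideanSpace ℝ (Fin 3))) x) →
    ∃ μ₁ : Measure (Torus.energySpace (Fin 3)), IsProbabilityMeasure μ₁ ∧ (∀ᵐ u ∂μ₁, (∀ k ∉ (Torus.freqBall N).erase (0 : Fin 3 → ℤ),
          UnitAddTorus.mFourierCoeff (EuclideanSpace.complexify ∘ (u.1 : UnitAddTorus (Fin 3) → EuclideanSpace ℝ (Fin 3))) k = 0)) ∧
      Integrable (fun u : Torus.energySpace (Fin 3) => ‖u‖ ^ 4) μ₁ ∧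
      (∀ (m : ℕ) (g : Fin m → UnitAddTorus (Fin 3) → EuclideanSpace ℝ (Fin 3))
      (P : MvPolynomial (Fin m) ℝ),
      (∀ i, (Torus.IsSmooth (g i) ∧ Torus.IsDivFree (g i) ∧ Torus.HasZeroMean (g i) ∧
        ∀ k ∉ (Torus.freqBall N).erase (0 : Fin 3 → ℤ),
          UnitAddTorus.mFourierCoeff (EuclideanSpace.complexify ∘ (g i)) k = 0)) → P.totalDegree ≤ 4 →
      (∀ u : Torus.energySpace (Fin 3), (∀ k ∉ (Torus.freqBall N).erase (0 : Fin 3 → ℤ),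
          UnitAddTorus.mFourierCoeff (EuclideanSpace.complexify ∘ (u.1 : UnitAddTorus (Fin 3) → EuclideanSpace ℝ (Fin 3))) k = 0) →
        0 ≤ MvPolynomial.eval (fun j => Torus.pairing u.1 (g j)) P) →
      (∃ u : Torus.energySpace (Fin 3), (∀ k ∉ (Torus.freqBall N).erase (0 : Fin 3 → ℤ),
          UnitAddTorus.mFourierCoeff (EuclideanSpace.complexify ∘ (u.1 : UnitAddTorus (Fin 3) → EuclideanSpace ℝ (Fin 3))) k = 0) ∧
        MvPolynomial.eval (fun j => Torus.pairing u.1 (g j)) P ≠ 0) →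
      0 < ∫ u, MvPolynomial.eval (fun j => Torus.pairing u.1 (g j)) P ∂μ₁) ∧
      (∀ (m : ℕ) (g : Fin m → UnitAddTorus (Fin 3) → EuclideanSpace ℝ (Fin 3))
      (P : MvPolynomial (Fin m) ℝ),
      (∀ i, (Torus.IsSmooth (g i) ∧ Torus.IsDivFree (g i) ∧ Torus.HasZeroMean (g i) ∧
        ∀ k ∉ (Torus.freqBall N).erase (0 : Fin 3 → ℤ),
          UnitAddTorus.mFourierCoeff (EuclideanSpace.complexify ∘ (g i)) k = 0)) → P.totalDegree + 1 ≤ 3 →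
      Integrable (fun u : Torus.energySpace (Fin 3) => Torus.nsGeneratorPairing ν f u
          (fun x => ∑ i, (MvPolynomial.eval (fun j => Torus.pairing u.1 (g j))
            (MvPolynomial.pderiv i P)) • g i x)) μ₁ ∧
      ∫ u, Torus.nsGeneratorPairing ν f u
          (fun x => ∑ i, (MvPolynomial.eval (fun j => Torus.pairing u.1 (g j))
            (MvPolynomial.pderiv i P)) • g i x) ∂μ₁ = 0) ∧
      Torus.ensembleEnergy μ₁ = Torus.ensembleEnergy μ₀ ∧
      Torus.ensembleDissipation ν μ₁ = Torus.ensembleDissipation ν μ₀ :=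
  Summit.AnomalousDissipation.AnomalousDissipation.Theorems.MomentParityQuarticGate.stub_order3Surgery

/-- **S6 — THE ORDER-2 DESIGN, ONE EXPLICIT FORCE (NEW: the (mean, covariance) tier of the old
`stub_order3LoudNondegenerate`; HELD BY THE LEAD).** Kolmogorov force `f = sin(2πy)e₁` on the unit
torus, `E = 2`, `ε = 1/4`, `ν₀` small: for every `ν ∈ (0,ν₀)` there is `N₀ = K(ν)+2`,
`K(ν) ≍ ν^{-1/2}`, such that for EVERY `N ≥ N₀` the law `μ₀` of
`u = U₀ sin(2πy)e₁ + A cos(2πKz+θ) + B cos(2π(Kz+y)+θ) + Σ_a c_a e_a`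
(`θ` uniform, `A = A₁e₁`, `B = (0, B₂, −B₂/K)`, `c` uniform on a small cube of frame coordinates,
independent — bounded support, nondegenerate covariance) has: all LINEAR rows exact
(`E[(u·∇)u] = −πA₁B₂ f` deterministically, so `P_N(f + νΔū − E B(u,u)) = (1 − 4π²νU₀ + πA₁B₂) f = 0`),
the ENERGY row exact (`νE‖∇u‖² = (f,ū) = U₀/2`, solved for the amplitude by the intermediate value
theorem) and the HELICITY row exact (mirror bookkeeping: `(curl f, ū) = 0`, `E(u, Δ curl u) = 0`,
`E b(u,u,curl u) = 0`), energy `≤ E`, dissipation `= U₀/2 ≥ ε`, uniformly in `N ≥ N₀` and `ν`.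
Individual mode budgets do NOT balance (they are absorbed at order 3 by S5) — only the two quadratic
Casimir budgets are honest constraints. Size L (explicit trigonometric bookkeeping + a pushforward
measure). See NOTES.md §K1a design for the computation. -/
theorem stub_order2Design :
    ∃ f : UnitAddTorus (Fin 3) → EuclideanSpace ℝ (Fin 3), Torus.IsSmooth f ∧ Torus.IsDivFree f ∧ Torus.HasZeroMean f ∧
    ∃ E ε ν₀ : ℝ, 0 < ε ∧ 0 < ν₀ ∧ ∀ ν : ℝ, 0 < ν → ν < ν₀ → ∃ N₀ : ℕ, ∀ N : ℕ, N₀ ≤ N →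
    ∃ μ₀ : Measure (Torus.energySpace (Fin 3)), IsProbabilityMeasure μ₀ ∧ (∀ᵐ u ∂μ₀, (∀ k ∉ (Torus.freqBall N).erase (0 : Fin 3 → ℤ),
          UnitAddTorus.mFourierCoeff (EuclideanSpace.complexify ∘ (u.1 : UnitAddTorus (Fin 3) → EuclideanSpace ℝ (Fin 3))) k = 0)) ∧
    (∃ R : ℝ, ∀ᵐ u ∂μ₀, ‖u‖ ≤ R) ∧
    (∀ g : UnitAddTorus (Fin 3) → EuclideanSpace ℝ (Fin 3), (Torus.IsSmooth (g) ∧ Torus.IsDivFree (g) ∧ Torus.HasZeroMean (g) ∧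
        ∀ k ∉ (Torus.freqBall N).erase (0 : Fin 3 → ℤ),
          UnitAddTorus.mFourierCoeff (EuclideanSpace.complexify ∘ (g)) k = 0) →
      (∃ u : Torus.energySpace (Fin 3), (∀ k ∉ (Torus.freqBall N).erase (0 : Fin 3 → ℤ),
          UnitAddTorus.mFourierCoeff (EuclideanSpace.complexify ∘ (u.1 : UnitAddTorus (Fin 3) → EuclideanSpace ℝ (Fin 3))) k = 0) ∧ Torus.pairing u.1 g ≠ 0) →
      (∫ u : Torus.energySpace (Fin 3), Torus.pairing u.1 g ∂μ₀) ^ 2 < ∫ u : Torus.energySpace (Fin 3), (Torus.pairing u.1 g) ^ 2 ∂μ₀) ∧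
    (∀ g : UnitAddTorus (Fin 3) → EuclideanSpace ℝ (Fin 3), (Torus.IsSmooth (g) ∧ Torus.IsDivFree (g) ∧ Torus.HasZeroMean (g) ∧
        ∀ k ∉ (Torus.freqBall N).erase (0 : Fin 3 → ℤ),
          UnitAddTorus.mFourierCoeff (EuclideanSpace.complexify ∘ (g)) k = 0) →
      Integrable (fun u : Torus.energySpace (Fin 3) => Torus.nsGeneratorPairing ν f u g) μ₀ ∧
      ∫ u : Torus.energySpace (Fin 3), Torus.nsGeneratorPairing ν f u g ∂μ₀ = 0) ∧
    (Integrable (fun u : Torus.energySpace (Fin 3) => Torus.nsGeneratorPairing ν f u (Torus.fourierTruncate N (u.1 : UnitAddTorus (Fin 3) → EuclideanSpace ℝ (Fin 3)))) μ₀ ∧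
      ∫ u : Torus.energySpace (Fin 3), Torus.nsGeneratorPairing ν f u (Torus.fourierTruncate N (u.1 : UnitAddTorus (Fin 3) → EuclideanSpace ℝ (Fin 3))) ∂μ₀ = 0) ∧
    (Integrable (fun u : Torus.energySpace (Fin 3) => Torus.nsGeneratorPairing ν f u
        (BDSV.curl (Torus.fourierTruncate N (u.1 : UnitAddTorus (Fin 3) → EuclideanSpace ℝ (Fin 3))))) μ₀ ∧
      ∫ u : Torus.energySpace (Fin 3), Torus.nsGeneratorPairing ν f u (BDSV.curl (Torus.fourierTruncate N (u.1 : UnitAddTorus (Fin 3) → EuclideanSpace ℝ (Fin 3)))) ∂μ₀ = 0) ∧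
    Torus.ensembleEnergy μ₀ ≤ E ∧ ε ≤ Torus.ensembleDissipation ν μ₀ :=
  Summit.AnomalousDissipation.AnomalousDissipation.Theorems.MomentParityQuarticGate.stub_order2Design


/-! ## The composition (kernel-checked, no `sorry` of its own) -/

/-- **`QuarticGate` from the six stubs.** Take `f, E, ε, ν₀` from S6 and `ν_j := ν₀/(j+2)`
(positive, `< ν₀`, `→ 0`). At each `j`: S6 gives `N₀`; S2's frequently-many clean levels meet
`N ≥ N₀` (`Frequently.and_eventually`); at such `N`, S6 gives the loud order-2 design `μ₀`, S5 (fed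
QuadRigidity) a Slater 3-stationary `μ₁` with the same energy/dissipation, S3 (fed S1 and
NoCubicCasimir) a defect certificate for `μ₁`, and S4 the 4-stationary `μ` with the same energy
`≤ E` and dissipation `≥ ε`. -/
theorem QuarticGate_of : QuarticGate := by
  obtain ⟨f, hfs, hfd, hfz, E, ε, ν₀, hε, hν₀, hK1⟩ := stub_order2Design
  have hνpos : ∀ j : ℕ, 0 < ν₀ / ((j : ℝ) + 2) := fun j => div_pos hν₀ (by positivity)
  have hνlt : ∀ j : ℕ, ν₀ / ((j : ℝ) + 2) < ν₀ := fun j => by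
    rw [div_lt_iff₀ (by positivity)]
    nlinarith [(Nat.cast_nonneg j : (0 : ℝ) ≤ j)]
  have hνlim : Tendsto (fun j : ℕ => ν₀ / ((j : ℝ) + 2)) atTop (nhds 0) :=
    tendsto_const_nhds.div_atTop
      (tendsto_atTop_add_const_right atTop (2 : ℝ) tendsto_natCast_atTop_atTop)
  refine ⟨f, hfs, hfd, hfz, fun j => ν₀ / ((j : ℝ) + 2), E, ε, hνpos, hνlim, hε, fun j => ?_⟩
  obtain ⟨N₀, hN₀⟩ := hK1 _ (hνpos j) (hνlt j)
  refine (stub_casimirs.and_eventually (eventually_ge_atTop N₀)).mono ?_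
  rintro N ⟨⟨hCub, hQuad⟩, hN⟩
  obtain ⟨μ₀, hp₀, hl₀, hR₀, hnd₀, hlin₀, hErow₀, hHrow₀, hE₀, hD₀⟩ := hN₀ N hN
  obtain ⟨μ₁, hp₁, hl₁, hi₁, hsl₁, hst₁, hE₁, hD₁⟩ :=
    stub_order3Surgery _ f N μ₀ hfs hp₀ hl₀ hR₀ hnd₀ hlin₀ hErow₀ hHrow₀ hQuad
  obtain ⟨M, v, c, hcert⟩ :=
    stub_defectCertificate stub_signLemma N hCub _ f hfs μ₁ hp₁ hl₁ hi₁
  obtain ⟨μ, hp, hl, hi, hst, hE, hD⟩ :=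
    stub_surgery _ f N μ₁ hfs hp₁ hl₁ hi₁ hsl₁ hst₁ M v c hcert
  refine ⟨μ, hp, hl, hi, hst, ?_, ?_⟩
  · rw [hE, hE₁]; exact hE₀
  · rw [hD, hD₁]; exact hD₀

end Summit.AnomalousDissipation.AnomalousDissipation.Cruxes.QuarticGate.RecessionCone
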